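import Summits.Ventures.PercRepro.RankLevelSetExplicitLin2KeyL

/-!
# PercRepro — THE LEVEL-17 THEOREM-M ROW OF C-025 OVER THE 5/8 RANGE: THE KEY AT `p = 82 928` (p9, S4; the key is p4's)

`proofs/SUBCLAIM-S4-p9.md` §S4.2⁗⁗. p4's THEOREM-M key `KeyL 17 p d` (RankLevelSetExplicitLin2KeyL) checked by the kernel at
`p = 82 928` on the coranks `18 ≤ d ≤ 81937` of THE 5/8 RANGE (`D' = 17 + 5·2^{14} = 81937`; the large-corank theorem
`c025_core_explicit_large_of58` takes the coranks beyond): `82 928` = the least `p` with the optimal Chernoff pair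
`16·n^n ≤ 2^n·(n − K)^{n−K}·K^K` at `n = p + D'`, `K = 17 + D'` (twin lean-drafts/p9/g7/twin/range58.py), at or above the key's
own floor and the bases `N₁ = 82 187`, `P₂ = 81 973` (RankLevelSetExplicitLin2Bases58); p4's sharp row sits at `132 332`
(RankLevelSetExplicitLin2IndepFloorS). The level step and the unconditional chain are RankLevelSetExplicitLin2IndepFloor58.
Axioms: standard (kernel `decide`).
-/
-- part A: chunks 1 … 8 of 40

namespace PercRepro

namespace ThmN

namespace Explicit

/-- The THEOREM-M key row at `(q, p) = (17, 82 928)`, chunk 1 of 40: coranks `18 … 2065`, by the kernel. -/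
theorem key_seventeen_indep58_row_1 : ∀ t < 2048, KeyL 17 82928 (18 + t) := by decide +kernel

/-- The THEOREM-M key row at `(q, p) = (17, 82 928)`, chunk 2 of 40: coranks `2066 … 4113`, by the kernel. -/
theorem key_seventeen_indep58_row_2 : ∀ t < 2048, KeyL 17 82928 (18 + (2048 + t)) := by decide +kernel

/-- The THEOREM-M key row at `(q, p) = (17, 82 928)`, chunk 3 of 40: coranks `4114 … 6161`, by the kernel. -/
theorem key_seventeen_indep58_row_3 : ∀ t < 2048, KeyL 17 82928 (18 + (4096 + t)) := by decide +kernel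

/-- The THEOREM-M key row at `(q, p) = (17, 82 928)`, chunk 4 of 40: coranks `6162 … 8209`, by the kernel. -/
theorem key_seventeen_indep58_row_4 : ∀ t < 2048, KeyL 17 82928 (18 + (6144 + t)) := by decide +kernel

/-- The THEOREM-M key row at `(q, p) = (17, 82 928)`, chunk 5 of 40: coranks `8210 … 10257`, by the kernel. -/
theorem key_seventeen_indep58_row_5 : ∀ t < 2048, KeyL 17 82928 (18 + (8192 + t)) := by decide +kernel

/-- The THEOREM-M key row at `(q, p) = (17, 82 928)`, chunk 6 of 40: coranks `10258 … 12305`, by the kernel. -/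
theorem key_seventeen_indep58_row_6 : ∀ t < 2048, KeyL 17 82928 (18 + (10240 + t)) := by decide +kernel

/-- The THEOREM-M key row at `(q, p) = (17, 82 928)`, chunk 7 of 40: coranks `12306 … 14353`, by the kernel. -/
theorem key_seventeen_indep58_row_7 : ∀ t < 2048, KeyL 17 82928 (18 + (12288 + t)) := by decide +kernel

/-- The THEOREM-M key row at `(q, p) = (17, 82 928)`, chunk 8 of 40: coranks `14354 … 16401`, by the kernel. -/
theorem key_seventeen_indep58_row_8 : ∀ t < 2048, KeyL 17 82928 (18 + (14336 + t)) := by decide +kernel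

end Explicit

end ThmN

end PercRepro
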